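import Summits.QuantumAdvantage.AdviceFreeQNC0.MeanLoad
import Mathlib.Analysis.SpecialFunctions.Log.Base
import HarnessLib

/-!
# Cell qa-qnc0 (rung F-S1, route RingFrame, crux α, line `tensor`): `LiftOneStrictLog → LiftOneLogStrict`
# — S1′ gives R1 on strict inputs (qn-p2 ROUND-4 PROP 2.2, ask T-c `CovLogSuffices`)

After `S1-REFUTED.md` (THEOREM A: `UnionBound`, `LiftOneStrict` = STRICT-U and `RankBound` are false;
kernel: `not_unionBound`, `not_liftOneStrict`, `not_rankBound`) the live strict rung of planner
qa-qnc0-p2's tensor line is **S1′ = `LiftOneStrictLog`** (lift cost `≤ K·w·(d+1)·2^L`, tight on the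
tensor-block family), and the link the line uses is PROP 2.2: S1′ implies R1 = `LiftOneLog` restricted
to strict inputs (`LiftOneLogStrict`: cost `≤ K·T·(1 + L + L' − log₂ T)`, `T = hw (X ⊕ Y)` the total
leader weight).  This file proves that implication,

* **`covLogSuffices : CovLogSuffices`** (`:= LiftOneStrictLog → LiftOneLogStrict`), constant `K' = 3K+1`:

in the NON-ADDITIVE case the `W` supplied by `LiftOneStrictLog` costs `≤ K·w·(d+1)·2^L ≤ 3K·T·(d+1)`
by the mean-load lemma (`avgLoad`, `MeanLoad.lean`: `w·2^L ≤ 2w·2^{L−1} ≤ f·2^{L−1} ≤ 3T`), and the log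
factor is `≥ d + 2` because `T·2^{d+1} ≤ 2^L·2w·2^d ≤ 2^L·f·2^d = 2^{L+L'}` (`logb_le_of_mul_pow_le`);
in the ADDITIVE case (all cocycle values zero) the leader map `u ↦ a_u` is itself linear, so `Y = X ⊕ a`
has linear columns (`ind_apply_eq_sum_of_additive`, `hasDeg_one_of_additive`, `linCols_of_additive`)
and `W := Y` costs exactly `T ≤ K'·T·(factor ≥ 1)` (`hw_le_pow`: `T ≤ 2^{L+L'}`).

Statements `LiftOneStrictLog`, `LiftOneLogStrict`, `CovLogSuffices` are VERBATIM from `Sketch4.lean`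
(shape check `Iff.rfl`, farm rc 0).  `LiftOneStrictLog` (S1′) and `LiftOneLogStrict` are qn-p2's OPEN
CONJECTURES and appear here only as the two ends of the proved implication (as `UnionBound`,
`LiftOneStrict` do in `unionBoundSuffices`, p464335).
WHAT THIS IS NOT: no proof of S1′ or R1; nothing on `TRPlus`, α or the separation. [folklore]
-/

namespace Summit.QuantumAdvantage.AdviceFreeQNC0

open Finset
open Literature.Computability.MetaComplexity Literature.Computability.MetaComplexity.Smolensky
open MeanLoad

/-- **S1′ = S1-log** (`Sketch4.LiftOneStrictLog` verbatim; what R1 needs from the strict regime,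
ROUND-4 PROP 2.2): the lift cost is `O(w·(d+1)·2^L)`.  qn-p2's CONJECTURE — OPEN (tight on the
tensor-block family of `S1-REFUTED.md`). -/
def LiftOneStrictLog : Prop :=
  ∃ K : ℝ, 0 < K ∧ ∀ (L L' d w : ℕ) (X Y : (Fin L → Bool) → (Fin L' → Bool) → Bool), StrictSys d w X Y →
    ∃ W : (Fin L → Bool) → (Fin L' → Bool) → Bool, LinCols W ∧ RowsDeg d W ∧
      (hw (xorM X W) : ℝ) ≤ K * w * (d + 1) * (2 : ℝ) ^ L

/-- R1 (`LiftOneLog`, ROUND-2 §A2) RESTRICTED to strict inputs with linear columns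
(`Sketch4.LiftOneLogStrict` verbatim).  qn-p2's CONJECTURE — OPEN. -/
def LiftOneLogStrict : Prop :=
  ∃ K : ℝ, 0 < K ∧ ∀ (L L' d w : ℕ) (X Y : (Fin L → Bool) → (Fin L' → Bool) → Bool), StrictSys d w X Y →
    ∃ W : (Fin L → Bool) → (Fin L' → Bool) → Bool, LinCols W ∧ RowsDeg d W ∧
      (hw (xorM X W) : ℝ) ≤ K * hw (xorM X Y) *
        (1 + ((L + L' : ℕ) : ℝ) - Real.logb 2 (hw (xorM X Y)))

/-- **T-c (qn-p2 ROUND-4 PROP 2.2; `Sketch4.CovLogSuffices` verbatim)**: S1-log gives R1 on strict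
inputs. -/
def CovLogSuffices : Prop := LiftOneStrictLog → LiftOneLogStrict

section

variable {L L' : ℕ}

/-! ### Additive leader systems: the leader map is linear, so `Y` has linear columns -/

/-- the row index with support `S`. -/
private def uOf (S : Finset (Fin L)) : Fin L → Bool := fun i => decide (i ∈ S)

/-- support of `insert i S` = support of `S` plus `eᵢ`. [folklore] -/
private theorem uOf_insert {S : Finset (Fin L)} {i : Fin L} (hi : i ∉ S) :
    uOf (insert i S) = bx (uOf S) (basisRow i) := by
  funext j
  unfold uOf bx basisRow
  by_cases hj : j = i
  · subst hj
    simp [hi]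
  · simp [hj]

/-- every row index is `uOf` of its support. [folklore] -/
private theorem uOf_filter (u : Fin L → Bool) : uOf (univ.filter fun i => u i = true) = u := by
  funext i
  unfold uOf
  simp

/-- An ADDITIVE Boolean function on `𝔽₂^L` (`g(u + u') = g(u) + g(u')`) is the sum of its values on
the basis: `[g u] = Σ_i [u i]·[g eᵢ]`. [folklore] -/
theorem ind_apply_eq_sum_of_additive {g : (Fin L → Bool) → Bool}
    (hadd : ∀ u u', g (bx u u') = xor (g u) (g u')) (u : Fin L → Bool) :
    (if g u = true then (1 : ZMod 2) else 0) =
      ∑ i, (if u i = true then (1 : ZMod 2) else 0) * (if g (basisRow i) = true then (1 : ZMod 2) else 0) := by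
  -- `g 0 = 0`
  have h0 : g (fun _ => false) = false := by
    have h := hadd (fun _ => false) (fun _ => false)
    have hb : bx (fun _ : Fin L => false) (fun _ => false) = fun _ => false := funext fun _ => rfl
    rw [hb] at h
    revert h
    cases g (fun _ => false) <;> decide
  -- induction on the support
  have main : ∀ S : Finset (Fin L), (if g (uOf S) = true then (1 : ZMod 2) else 0) =
      ∑ i ∈ S, (if g (basisRow i) = true then (1 : ZMod 2) else 0) := by
    intro S
    induction S using Finset.induction_on with
    | empty =>
        have : uOf (∅ : Finset (Fin L)) = fun _ => false := funext fun i => by simp [uOf]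
        rw [this, h0, Finset.sum_empty]
        rfl
    | @insert i S hi ih =>
        rw [uOf_insert hi, hadd, ind_xor, ih, Finset.sum_insert hi, add_comm]
  have h := main (univ.filter fun i => u i = true)
  rw [uOf_filter] at h
  rw [h, Finset.sum_filter]
  refine Finset.sum_congr rfl fun i _ => ?_
  by_cases hu : u i = true
  · rw [if_pos hu, if_pos hu, one_mul]
  · rw [if_neg hu, if_neg hu, zero_mul]

/-- An additive Boolean function on `𝔽₂^L` has `𝔽₂`-degree `≤ 1`. [folklore] -/
theorem hasDeg_one_of_additive {g : (Fin L → Bool) → Bool}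
    (hadd : ∀ u u', g (bx u u') = xor (g u) (g u')) : HasDeg g 1 := by
  show (fun u => if g u = true then (1 : ZMod 2) else 0) ∈ lowDeg (ZMod 2) L 1
  have hfun : (fun u => if g u = true then (1 : ZMod 2) else 0) =
      ∑ i, (if g (basisRow i) = true then (1 : ZMod 2) else 0) • mono (ZMod 2) ({i} : Finset (Fin L)) := by
    funext u
    rw [ind_apply_eq_sum_of_additive hadd u, Finset.sum_apply]
    refine Finset.sum_congr rfl fun i _ => ?_
    rw [Pi.smul_apply, smul_eq_mul, mono_apply]
    simp only [Finset.mem_singleton, forall_eq]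
    ring
  rw [hfun]
  exact Submodule.sum_mem _ fun i _ =>
    Submodule.smul_mem _ _ (mono_mem_lowDeg (by rw [Finset.card_singleton]))

/-- **In an ADDITIVE strictly light system `Y` itself has linear columns.** -/
theorem linCols_of_additive {d w : ℕ} {X Y : (Fin L → Bool) → (Fin L' → Bool) → Bool}
    (hS : StrictSys d w X Y) (hA : ¬ NonAdditive X Y) : LinCols Y := by
  obtain ⟨_, hX, _, _⟩ := hS
  unfold NonAdditive at hA
  push Not at hA
  -- the leader columns are additive
  have hadd : ∀ v u u', ldr X Y (bx u u') v = xor (ldr X Y u v) (ldr X Y u' v) := by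
    intro v u u'
    have h := hA u u' v
    have key : ∀ a b c : Bool, xor a (xor b c) ≠ true → c = xor a b := by decide
    exact key _ _ _ (by simpa [phi] using h)
  have hYeq : ∀ u v, Y u v = xor (X u v) (ldr X Y u v) := by
    intro u v; unfold ldr; cases X u v <;> cases Y u v <;> rfl
  refine ⟨fun v => ?_, fun v => ?_⟩
  · have h : (fun u => Y u v) = fun u => xor (X u v) (ldr X Y u v) := funext fun u => hYeq u v
    rw [h]
    exact hasDeg_xor (hX.1 v) (hasDeg_one_of_additive fun u u' => hadd v u u')
  · rw [hYeq, hX.2 v, Bool.false_xor]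
    have h := hadd v (fun _ => false) (fun _ => false)
    have hb : bx (fun _ : Fin L => false) (fun _ => false) = fun _ => false := funext fun _ => rfl
    rw [hb] at h
    revert h
    cases ldr X Y (fun _ => false) v <;> decide

/-! ### Bookkeeping for T-c -/

/-- `hw (X ⊕ Y) = Σ_u |a_u|` (cells counted row by row). -/
theorem hw_xorM_eq_sum_rowDist (X Y : (Fin L → Bool) → (Fin L' → Bool) → Bool) :
    hw (xorM X Y) = ∑ u, rowDist X Y u := by
  rw [hw_eq_sum_rows]
  refine Finset.sum_congr rfl fun u _ => ?_
  rw [rowDist_eq_card_ldr]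
  rfl

/-- `Σ_u |a_u| ≤ 2^L · w`. -/
theorem sum_rowDist_le {d w : ℕ} {X Y : (Fin L → Bool) → (Fin L' → Bool) → Bool}
    (hS : StrictSys d w X Y) : ∑ u, rowDist X Y u ≤ 2 ^ L * w := by
  calc ∑ u, rowDist X Y u ≤ ∑ _u : Fin L → Bool, w := Finset.sum_le_sum fun u _ => hS.2.2.2 u
    _ = 2 ^ L * w := by rw [Finset.sum_const, Finset.card_univ, card_rows, smul_eq_mul]

/-- `hw M ≤ 2^{L+L'}`. [folklore] -/
theorem hw_le_pow (M : (Fin L → Bool) → (Fin L' → Bool) → Bool) : hw M ≤ 2 ^ (L + L') := by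
  unfold hw
  refine (Finset.card_le_univ _).trans (le_of_eq ?_)
  rw [Fintype.card_prod, Fintype.card_fun, Fintype.card_fun, Fintype.card_bool, Fintype.card_fin,
    Fintype.card_fin, pow_add]

end

/-- `log₂ T ≤ a − b` when `T·2^b ≤ 2^a` (`T ≥ 1`). [folklore] -/
theorem logb_le_of_mul_pow_le {T a b : ℕ} (hT : 0 < T) (h : T * 2 ^ b ≤ 2 ^ a) :
    Real.logb 2 (T : ℝ) ≤ (a : ℝ) - b := by
  have hT' : (0 : ℝ) < T := by exact_mod_cast hT
  have h' : (T : ℝ) * (2 : ℝ) ^ b ≤ (2 : ℝ) ^ a := by exact_mod_cast h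
  have hlog2 : 0 < Real.log 2 := Real.log_pos (by norm_num)
  rw [Real.logb, div_le_iff₀ hlog2]
  have h1 : Real.log ((T : ℝ) * (2 : ℝ) ^ b) ≤ Real.log ((2 : ℝ) ^ a) :=
    Real.log_le_log (by positivity) h'
  rw [Real.log_mul hT'.ne' (by positivity), Real.log_pow, Real.log_pow] at h1
  linarith

/-! ### T-c: `LiftOneStrictLog → LiftOneLogStrict` -/

/-- **`covLogSuffices : CovLogSuffices`** (qn-p2 ROUND-4 PROP 2.2): S1′ implies R1 on strict inputs,
with constant `K' = 3K + 1`. -/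
theorem covLogSuffices : CovLogSuffices := by
  rintro ⟨K, hK, hyp⟩
  refine ⟨3 * K + 1, by positivity, fun L L' d w X Y hS => ?_⟩
  -- notation: `T = hw (X ⊕ Y) = Σ_u |a_u|`, the log factor `Φ ≥ 1`
  have hT : hw (xorM X Y) = ∑ u, rowDist X Y u := hw_xorM_eq_sum_rowDist X Y
  have hfac : (1 : ℝ) ≤ 1 + ((L + L' : ℕ) : ℝ) - Real.logb 2 (hw (xorM X Y)) := by
    rcases Nat.eq_zero_or_pos (hw (xorM X Y)) with h0 | hpos
    · rw [h0, Nat.cast_zero, Real.logb_zero]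
      have : (0 : ℝ) ≤ ((L + L' : ℕ) : ℝ) := Nat.cast_nonneg _
      linarith
    · have h := logb_le_of_mul_pow_le (a := L + L') (b := 0) hpos
        (by rw [pow_zero, mul_one]; exact hw_le_pow _)
      push_cast at h ⊢
      linarith
  by_cases hN : NonAdditive X Y
  · -- non-additive: use the `W` of `LiftOneStrictLog`; mean load gives `w·2^L ≤ 3T`, and the log
    -- factor is `≥ d + 2`
    obtain ⟨W, hWl, hWd, hWc⟩ := hyp L L' d w X Y hS
    refine ⟨W, hWl, hWd, hWc.trans ?_⟩
    have havg := avgLoad L L' d w X Y hS hN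
    obtain ⟨hw2, hX, hY, hle⟩ := hS
    have hsumle : ∑ u, rowDist X Y u ≤ 2 ^ L * w := sum_rowDist_le ⟨hw2, hX, hY, hle⟩
    -- `w·2^L ≤ 3T` in `ℕ`
    have hpowL : 2 ^ L ≤ 2 * 2 ^ (L - 1) := by
      rcases Nat.eq_zero_or_pos L with h0 | hpos
      · subst h0; norm_num
      · rw [← Nat.pow_succ']; exact Nat.pow_le_pow_right (by norm_num) (by omega)
    have hw3 : w * 2 ^ L ≤ 3 * ∑ u, rowDist X Y u := by
      calc w * 2 ^ L ≤ w * (2 * 2 ^ (L - 1)) := Nat.mul_le_mul_left _ hpowL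
        _ = 2 * w * 2 ^ (L - 1) := by ring
        _ ≤ 2 ^ (L' - d) * 2 ^ (L - 1) := Nat.mul_le_mul_right _ hw2.le
        _ = 2 ^ (L - 1) * 2 ^ (L' - d) := by ring
        _ ≤ 3 * ∑ u, rowDist X Y u := havg
    -- `T ≥ 1`, so `w ≥ 1` and `d < L'`
    have hTpos : 0 < ∑ u, rowDist X Y u := by
      have : 0 < 2 ^ (L - 1) * 2 ^ (L' - d) := by positivity
      omega
    have hwpos : 0 < w := by
      by_contra h0
      push Not at h0
      have : w = 0 := by omega
      subst this
      rw [mul_zero] at hsumle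
      omega
    have hdL : d < L' := by
      by_contra h
      push Not at h
      have : L' - d = 0 := by omega
      rw [this, pow_zero] at hw2
      omega
    -- `T·2^{d+1} ≤ 2^{L+L'}`: `2T ≤ 2^L·2w ≤ 2^L·f` and `f·2^d = 2^{L'}`
    have hTd : (∑ u, rowDist X Y u) * 2 ^ (d + 1) ≤ 2 ^ (L + L') := by
      have hf : 2 ^ (L' - d) * 2 ^ d = 2 ^ L' := by rw [← pow_add]; congr 1; omega
      calc (∑ u, rowDist X Y u) * 2 ^ (d + 1) = 2 * (∑ u, rowDist X Y u) * 2 ^ d := by ring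
        _ ≤ 2 * (2 ^ L * w) * 2 ^ d := by gcongr
        _ = 2 ^ L * (2 * w) * 2 ^ d := by ring
        _ ≤ 2 ^ L * 2 ^ (L' - d) * 2 ^ d := by gcongr
        _ = 2 ^ L * (2 ^ (L' - d) * 2 ^ d) := by ring
        _ = 2 ^ (L + L') := by rw [hf, pow_add]
    have hlog := logb_le_of_mul_pow_le (a := L + L') (b := d + 1) hTpos hTd
    -- assemble in `ℝ`
    have hw3R : (w : ℝ) * (2 : ℝ) ^ L ≤ 3 * ((∑ u, rowDist X Y u : ℕ) : ℝ) := by exact_mod_cast hw3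
    have hfacd : ((d : ℝ) + 1) ≤ 1 + ((L + L' : ℕ) : ℝ) - Real.logb 2 (hw (xorM X Y)) := by
      rw [hT]; push_cast at hlog ⊢; linarith
    have hTR : (0 : ℝ) ≤ ((hw (xorM X Y) : ℕ) : ℝ) := Nat.cast_nonneg _
    rw [hT] at hfacd hTR hfac ⊢
    set T : ℝ := ((∑ u, rowDist X Y u : ℕ) : ℝ) with hTdef
    set Φ : ℝ := 1 + ((L + L' : ℕ) : ℝ) - Real.logb 2 T with hΦdef
    have hd0 : (0 : ℝ) ≤ (d : ℝ) + 1 := by positivity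
    calc K * w * (d + 1) * (2 : ℝ) ^ L = K * ((w : ℝ) * (2 : ℝ) ^ L) * ((d : ℝ) + 1) := by ring
      _ ≤ K * (3 * T) * ((d : ℝ) + 1) := by gcongr
      _ ≤ K * (3 * T) * Φ := by gcongr
      _ = 3 * K * T * Φ := by ring
      _ ≤ (3 * K + 1) * T * Φ := by
          have : 0 ≤ T * Φ := mul_nonneg hTR (le_trans zero_le_one hfac)
          nlinarith
  · -- additive: `W := Y` has linear columns and costs exactly `T`
    refine ⟨Y, linCols_of_additive hS hN, hS.2.2.1, ?_⟩
    have hTR : (0 : ℝ) ≤ ((hw (xorM X Y) : ℕ) : ℝ) := Nat.cast_nonneg _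
    set T : ℝ := ((hw (xorM X Y) : ℕ) : ℝ)
    set Φ : ℝ := 1 + ((L + L' : ℕ) : ℝ) - Real.logb 2 T
    calc T = 1 * T * 1 := by ring
      _ ≤ (3 * K + 1) * T * Φ := by gcongr; linarith

end Summit.QuantumAdvantage.AdviceFreeQNC0
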